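import Mathlib.MeasureTheory.Measure.Haar.NormedSpace       -- `Measure.integral_comp_smul` (the blow-up `W = √ε·w` in `ℂ² = ℝ⁴`)
import Literature.Geometry.ComplexHyperbolic.UnitBallHyperboloidChart       -- ★ the chart: `β = 9·d⁴W`, `∫_{𝔹²} Θ(u•1 + c•P) dβ = 9∫_{ℂ²} Θ(u•1 − c•N(W,√(1+|W|²))) d⁴W`
import HarnessLib

/-!
# The `ε²`-normalised `K`-central orbital integrals of `U(2,1)` are integrals over the sheets `Q = −ε`, and converge to the cone integral
# at the centre (ROAD A (A3-b), analytic toolkit IV: the leading term)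

Topic `Geometry/ComplexHyperbolic`; namespace `Literature.Geometry.ComplexHyperbolic.BallModel`.  THEOREMS ONLY (no `def`, no instance, no notation,
no axiom, no named fact, no `sorry`).  Cell `pub/hodgecm-mathlib`, ENGINE T1 (crux H413 = `stmt-HodgeConjecture-24833`); floor-1½ preparation, count-neutral,
under row (S-d) ∕ «SdArch» ED. 3 node N1 = the (L_{U(2,1)}) letter ★ `ArchCentralLimitFormulaRankTwo` (`stub_ArchCentralLimitU21`): brick **ROAD A (A3-b) IV**
(F0P3a-p03 (g10) census c3af6e58 §2 (A3); A-p14 (g28) cost census e5e8455f §3; LEAD F0P3a-plan (g10) WORD T9-1 (4), 2026-09-01; author F0P3a-p05 (g13)).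
Continues ★ `UnitBallHyperboloidChart` (the chart `β = 9·d⁴W`; `K`-central ball averages over the sheet `Q = −1`), ★ `UnitBallKCentralBlowUp` (support radius).

THE MATHEMATICS.  With `x(W, ε) := (W₀, W₁, √(ε + |W|²))` (the sheet `Q = −ε` over `W ∈ ℂ²`) and `N(x) = x x* J`:  (1) THE BLOW-UP.  For `ε > 0`
substitute `W ↦ √ε·W` in `ℂ² = ℝ⁴` (`d⁴W ↦ ε² d⁴W`, Mathlib `Measure.integral_comp_smul` with `finrank_ℝ ℂ² = 4`; `N(√ε·x) = ε·N(x)`; `√ε·x(W,1) = x(√εW, ε)`)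
in ★ `integral_bergmanVolume_pencil_eq_chart`:
  **`ε² · ∫_{𝔹²} Θ(u•1 + (εη)•P(lift z)) dβ(z) = 9 ∫_{ℂ²} Θ(u•1 − η•N(W, √(ε+|W|²))) d⁴W`**   (EVERY `Θ`, `u η ∈ ℂ`, `ε > 0`; no hypothesis on `Θ`).
So `ε²` IS the normaliser of the `K`-central orbital integrals at `k_ε = diag(u,u,u+εη)` (★ `mat_conj_kCentral_eq`), and the normalised integral is an
integral over the SHEET `Q = −ε` against a FIXED measure; at `ε = 0` the sheet is the NULL CONE `{(W, |W|)}`, `N(W,|W|)` square-zero of rank one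
(★ `vecMulVec_star_mul_J_mul_self_of_Q_eq_zero`): the asymptotic cone of the degenerating semisimple orbit is the (translated) minimal nilpotent cone.
(2) THE LEADING TERM.  For `Θ` continuous with compact support and `η ≠ 0` the sheet integrand vanishes for `|W|² ≥ R∕|η|` UNIFORMLY in `ε ≥ 0` (its `(2,2)`
entry is `u + η(ε+|W|²)`; ★ `exists_radius_apply_add_eq_zero`), it is jointly continuous in `(ε, W)`, so by dominated convergence (majorant `C·𝟙{|W|² ≤ M}` on a
compact set) `ε ↦ ∫_{ℂ²} Θ(u•1 − η•N(W, √(ε+|W|²))) d⁴W` is continuous on `[0,∞)` and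
  **`ε² · ∫_{𝔹²} Θ(u•1 + (εη)•P(lift z)) dβ(z) ⟶ 9 ∫_{ℂ²} Θ(u•1 − η•N(W, |W|)) d⁴W`  as `ε → 0⁺`** (`|W| = √(nsq W)`).
Next bricks (A3-c): the same chart gives `∂_ε`, `∂_ε²` under the integral with majorant `C(1+|W|⁻²)·𝟙{|W|²≤S}` (integrable on `ℝ⁴`).

* §1 `finrank_real_fin_two_complex`, `vecCons_sqrt_smul`, `vecMulVec_real_smul_star_mul_J`, **`sq_smul_integral_bergmanVolume_pencil_eq_chart`**;
* §2 `continuous_vecCons_sqrt`, `continuous_sheet_integrand`, **`exists_nsq_bound_sheet_integrand_eq_zero`** (uniform support), **`continuousOn_integral_sheet`**,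
  **`tendsto_sq_smul_integral_bergmanVolume_pencil`** (the leading term).
HONEST LABEL: HC_CM is proved only modulo the printed citations until rung 0 closes; this file is real analysis over ★ ball-model files and pays nothing by itself.

## References
* [Rogawski1990] J. D. Rogawski, *Automorphic Representations of Unitary Groups in Three Variables*, Ann. of Math. Stud. 123 (1990), §8.4 pp. 126–127 (normalisation of the
  singular orbital integrals at the compact wall; the central limit formula on `U(2,1)`).
* [Varadarajan1989] V. S. Varadarajan, *An Introduction to Harmonic Analysis on Semisimple Lie Groups* (1989), §6.4 (limit formulas; nilpotent cones as asymptotic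
  cones of degenerating semisimple orbits).
* [Goldman1999] W. M. Goldman, *Complex Hyperbolic Geometry* (1999), §3.1.1–3.1.2 (hyperboloid model, negative lines).
* [Rudin1980] W. Rudin, *Function Theory in the Unit Ball of ℂⁿ* (1980), §1.4, §2.2.
-/

noncomputable section

open MeasureTheory MeasureTheory.Measure Set Matrix Complex ComplexConjugate Filter Topology
open scoped ENNReal

namespace Literature.Geometry.ComplexHyperbolic.BallModel

/-! ### §1 The blow-up `W = √ε · w`: `ε²` is the normaliser, and the sheets `Q = −ε` degenerate to the null cone -/

/-- `dim_ℝ (Fin 2 → ℂ) = 4`. [cite: Rudin1980, §1.4] -/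
theorem finrank_real_fin_two_complex : Module.finrank ℝ (Fin 2 → ℂ) = 4 := by
  rw [Module.finrank_pi_fintype]
  simp [Complex.finrank_real_complex]

/-- Scaling the sheet point: `(√ε W, √(ε + |√ε W|²)) = √ε · (W, √(1+|W|²))` for `ε ≥ 0`. [cite: Goldman1999, §3.1.1] -/
theorem vecCons_sqrt_smul (W : Fin 2 → ℂ) {ε : ℝ} (hε : 0 ≤ ε) :
    (![(Real.sqrt ε • W) 0, (Real.sqrt ε • W) 1, (Real.sqrt (ε + nsq (Real.sqrt ε • W)) : ℂ)] : Fin 3 → ℂ) =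
      ((Real.sqrt ε : ℝ) : ℂ) • ![W 0, W 1, (Real.sqrt (1 + nsq W) : ℂ)] := by
  have h1 : ε + nsq (Real.sqrt ε • W) = ε * (1 + nsq W) := by rw [nsq_real_smul, Real.sq_sqrt hε]; ring
  have h2 : Real.sqrt (ε + nsq (Real.sqrt ε • W)) = Real.sqrt ε * Real.sqrt (1 + nsq W) := by
    rw [h1, Real.sqrt_mul hε]
  funext i
  fin_cases i
  · simp [Complex.real_smul]
  · simp [Complex.real_smul]
  · simp [h2]

/-- `N(c•x) = |c|²•N(x)` for a REAL scalar `c`: `N(√ε·x) = ε·N(x)` (`ε ≥ 0`). [cite: Goldman1999, §3.1.1] -/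
theorem vecMulVec_real_smul_star_mul_J (x : Fin 3 → ℂ) {ε : ℝ} (hε : 0 ≤ ε) :
    vecMulVec (((Real.sqrt ε : ℝ) : ℂ) • x) (star (((Real.sqrt ε : ℝ) : ℂ) • x)) * J = ((ε : ℝ) : ℂ) • (vecMulVec x (star x) * J) := by
  rw [star_smul, smul_vecMulVec, vecMulVec_smul, smul_smul, Complex.star_def, Complex.conj_ofReal, ← Complex.ofReal_mul,
    Real.mul_self_sqrt hε, Matrix.smul_mul]

/-- **`ε²` IS THE NORMALISER — CHART FORM** (every `Θ`, `u η ∈ ℂ`, `ε > 0`; no hypothesis on `Θ`):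
`ε² · ∫_{𝔹²} Θ(u•1 + (εη)•P(lift z)) dβ(z) = 9 ∫_{ℂ²} Θ(u•1 − η•N(W, √(ε+|W|²))) d⁴W`.
The substitution `W = √ε·w` in `ℂ² = ℝ⁴` (Mathlib `Measure.integral_comp_smul`) absorbs exactly `ε²`; the point `(W, √(ε+|W|²))` runs over the sheet
`Q = −ε`, which at `ε = 0` is the null cone `{(W, |W|)}` — compare the ray form ★ `sq_smul_integral_bergmanVolume_pencil_eq`.
[cite: Rogawski1990, §8.4 pp. 126–127] [cite: Goldman1999, §3.1.1] [cite: Rudin1980, §2.2] -/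
theorem sq_smul_integral_bergmanVolume_pencil_eq_chart {G : Type*} [NormedAddCommGroup G] [NormedSpace ℝ G]
    (Θ : Matrix (Fin 3) (Fin 3) ℂ → G) (u η : ℂ) {ε : ℝ} (hε : 0 < ε) :
    ε ^ 2 • (∫ z, Θ (u • (1 : Matrix (Fin 3) (Fin 3) ℂ) + ((ε : ℂ) * η) •
        ((((Q (lift z) : ℝ) : ℂ))⁻¹ • (vecMulVec (lift z) (star (lift z)) * J))) ∂bergmanVolume) =
      (9 : ℝ) • ∫ W : Fin 2 → ℂ, Θ (u • (1 : Matrix (Fin 3) (Fin 3) ℂ) -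
        η • (vecMulVec ![W 0, W 1, (Real.sqrt (ε + nsq W) : ℂ)] (star ![W 0, W 1, (Real.sqrt (ε + nsq W) : ℂ)]) * J)) := by
  rw [integral_bergmanVolume_pencil_eq_chart, smul_comm]
  congr 1
  -- the integrand on the sheet `Q = −ε`, as a function on `ℂ²`
  set g : (Fin 2 → ℂ) → G := fun V => Θ (u • (1 : Matrix (Fin 3) (Fin 3) ℂ) -
    η • (vecMulVec ![V 0, V 1, (Real.sqrt (ε + nsq V) : ℂ)] (star ![V 0, V 1, (Real.sqrt (ε + nsq V) : ℂ)]) * J)) with hg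
  have key : ∀ W : Fin 2 → ℂ, Θ (u • (1 : Matrix (Fin 3) (Fin 3) ℂ) -
      ((ε : ℂ) * η) • (vecMulVec ![W 0, W 1, (Real.sqrt (1 + nsq W) : ℂ)] (star ![W 0, W 1, (Real.sqrt (1 + nsq W) : ℂ)]) * J)) =
      g (Real.sqrt ε • W) := by
    intro W
    simp only [hg]
    rw [vecCons_sqrt_smul W hε.le, vecMulVec_real_smul_star_mul_J _ hε.le, smul_smul, mul_comm η]
  have h4 : Real.sqrt ε ^ Module.finrank ℝ (Fin 2 → ℂ) = ε ^ 2 := by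
    rw [finrank_real_fin_two_complex, show (4 : ℕ) = 2 * 2 from rfl, pow_mul, Real.sq_sqrt hε.le]
  simp_rw [key]
  rw [Measure.integral_comp_smul volume g (Real.sqrt ε), h4, abs_of_pos (inv_pos.2 (pow_pos hε 2)), smul_smul,
    mul_inv_cancel₀ (pow_ne_zero 2 hε.ne'), one_smul]

/-! ### §2 Support on the sheets and the leading term as `ε → 0⁺` -/

/-- The sheet point `(W, √(ε+|W|²))` depends continuously on `(ε, W)`. [cite: Goldman1999, §3.1.1] -/
theorem continuous_vecCons_sqrt : Continuous fun p : ℝ × (Fin 2 → ℂ) => (![p.2 0, p.2 1, (Real.sqrt (p.1 + nsq p.2) : ℂ)] : Fin 3 → ℂ) := by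
  have h0 : Continuous fun p : ℝ × (Fin 2 → ℂ) => p.2 0 := (continuous_apply 0).comp continuous_snd
  have h1 : Continuous fun p : ℝ × (Fin 2 → ℂ) => p.2 1 := (continuous_apply 1).comp continuous_snd
  have h2 : Continuous fun p : ℝ × (Fin 2 → ℂ) => ((Real.sqrt (p.1 + nsq p.2) : ℝ) : ℂ) :=
    Complex.continuous_ofReal.comp ((continuous_fst.add (continuous_fun_nsq.comp continuous_snd)).sqrt)
  exact h0.matrixVecCons (h1.matrixVecCons (h2.matrixVecCons continuous_const))

/-- The sheet integrand `(ε, W) ↦ Θ(u•1 − η•N(W, √(ε+|W|²)))` is jointly continuous for continuous `Θ`. [cite: Goldman1999, §3.1.1] -/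
theorem continuous_sheet_integrand {G : Type*} [TopologicalSpace G] (Θ : Matrix (Fin 3) (Fin 3) ℂ → G) (hΘ : Continuous Θ) (u η : ℂ) :
    Continuous fun p : ℝ × (Fin 2 → ℂ) => Θ (u • (1 : Matrix (Fin 3) (Fin 3) ℂ) -
      η • (vecMulVec ![p.2 0, p.2 1, (Real.sqrt (p.1 + nsq p.2) : ℂ)] (star ![p.2 0, p.2 1, (Real.sqrt (p.1 + nsq p.2) : ℂ)]) * J)) :=
  hΘ.comp (continuous_const.sub ((continuous_vecMulVec_star_mul_J.comp continuous_vecCons_sqrt).const_smul η))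

/-- **UNIFORM SUPPORT ON THE SHEETS**: for `Θ` with compact support and `η ≠ 0` there is `M > 0` with `Θ(u•1 − η•N(W, √(ε+|W|²))) = 0` whenever
`|W|² ≥ M`, for EVERY `ε ≥ 0` (the `(2,2)` entry of `η•N` is `−η(ε + |W|²)`, ★ `exists_radius_apply_add_eq_zero`). [cite: Rudin1980, §1.4] [cite: Rogawski1990, §8.4 pp. 126–127] -/
theorem exists_nsq_bound_sheet_integrand_eq_zero {G : Type*} [Zero G] [TopologicalSpace G] (Θ : Matrix (Fin 3) (Fin 3) ℂ → G)
    (hΘc : HasCompactSupport Θ) (u : ℂ) {η : ℂ} (hη : η ≠ 0) :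
    ∃ M : ℝ, 0 < M ∧ ∀ ε : ℝ, 0 ≤ ε → ∀ W : Fin 2 → ℂ, M ≤ nsq W →
      Θ (u • (1 : Matrix (Fin 3) (Fin 3) ℂ) -
        η • (vecMulVec ![W 0, W 1, (Real.sqrt (ε + nsq W) : ℂ)] (star ![W 0, W 1, (Real.sqrt (ε + nsq W) : ℂ)]) * J)) = 0 := by
  obtain ⟨R, hR, hRΘ⟩ := exists_radius_apply_add_eq_zero Θ hΘc u
  have hηpos : 0 < ‖η‖ := norm_pos_iff.2 hη
  refine ⟨R / ‖η‖, by positivity, fun ε hε W hW => ?_⟩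
  have hεW : 0 ≤ ε + nsq W := by linarith [nsq_nonneg W]
  rw [sub_eq_add_neg, ← neg_smul]
  apply hRΘ
  rw [Matrix.smul_apply, smul_eq_mul, vecMulVec_vecCons_sqrt_mul_J_apply_two_two ε W hεW, norm_mul, norm_neg, norm_neg, Complex.norm_real,
    Real.norm_of_nonneg hεW]
  rw [div_le_iff₀ hηpos] at hW
  nlinarith

/-- **CONTINUITY ACROSS THE SHEETS DOWN TO THE CONE**: for `Θ` continuous with compact support and `η ≠ 0`, the chart-side integral
`ε ↦ ∫_{ℂ²} Θ(u•1 − η•N(W, √(ε+|W|²))) d⁴W` is continuous on `[0, ∞)` (dominated convergence, majorant `C·𝟙{|W|² ≤ M}`).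
[cite: Rogawski1990, §8.4 pp. 126–127] [cite: Rudin1980, §1.4] -/
theorem continuousOn_integral_sheet {G : Type*} [NormedAddCommGroup G] [NormedSpace ℝ G] (Θ : Matrix (Fin 3) (Fin 3) ℂ → G)
    (hΘ : Continuous Θ) (hΘc : HasCompactSupport Θ) (u : ℂ) {η : ℂ} (hη : η ≠ 0) :
    ContinuousOn (fun ε : ℝ => ∫ W : Fin 2 → ℂ, Θ (u • (1 : Matrix (Fin 3) (Fin 3) ℂ) -
      η • (vecMulVec ![W 0, W 1, (Real.sqrt (ε + nsq W) : ℂ)] (star ![W 0, W 1, (Real.sqrt (ε + nsq W) : ℂ)]) * J))) (Ici 0) := by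
  obtain ⟨M, hM, hvan⟩ := exists_nsq_bound_sheet_integrand_eq_zero Θ hΘc u hη
  obtain ⟨C, hC⟩ := hΘc.exists_bound_of_continuous hΘ
  have hC0 : 0 ≤ C := (norm_nonneg _).trans (hC 0)
  have hjoint := continuous_sheet_integrand Θ hΘ u η
  -- the majorant lives on the compact set `{|W|² ≤ M}`
  have hK : IsCompact {W : Fin 2 → ℂ | nsq W ≤ M} := by
    refine Metric.isCompact_of_isClosed_isBounded (isClosed_le continuous_fun_nsq continuous_const) ?_
    refine (Metric.isBounded_closedBall (x := (0 : Fin 2 → ℂ)) (r := Real.sqrt M)).subset fun W hW => ?_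
    simp only [mem_setOf_eq] at hW
    rw [mem_closedBall_zero_iff, pi_norm_le_iff_of_nonneg (Real.sqrt_nonneg M)]
    intro i
    refine Real.le_sqrt_of_sq_le ?_  -- hmm name
    have h0 : ‖W 0‖ ^ 2 ≤ M := by unfold nsq at hW; nlinarith [sq_nonneg ‖W 1‖]
    have h1 : ‖W 1‖ ^ 2 ≤ M := by unfold nsq at hW; nlinarith [sq_nonneg ‖W 0‖]
    fin_cases i
    · exact h0
    · exact h1
  have hKm : MeasurableSet {W : Fin 2 → ℂ | nsq W ≤ M} := (isClosed_le continuous_fun_nsq continuous_const).measurableSet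
  refine continuousOn_of_dominated (bound := fun W => ({W : Fin 2 → ℂ | nsq W ≤ M}).indicator (fun _ => C) W) ?_ ?_ ?_ ?_
  · intro ε _
    exact (hjoint.comp (Continuous.prodMk_right ε)).aestronglyMeasurable
  · intro ε hε
    refine Filter.Eventually.of_forall fun W => ?_
    by_cases hW : nsq W ≤ M
    · rw [indicator_of_mem (show W ∈ {W : Fin 2 → ℂ | nsq W ≤ M} from hW)]
      exact hC _
    · rw [indicator_of_notMem (show W ∉ {W : Fin 2 → ℂ | nsq W ≤ M} from hW)]
      have h := hvan ε hε W (le_of_lt (not_le.1 hW))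
      simp only [h, norm_zero, le_refl]
  · exact (integrable_indicator_iff hKm).2 (integrableOn_const (hK.measure_lt_top.ne))
  · exact Filter.Eventually.of_forall fun W => (hjoint.comp (Continuous.prodMk_left W)).continuousOn

/-- **THE LEADING TERM (ROAD A (A3-b)): `ε²·Φ(k_ε) → 9 × THE CONE INTEGRAL`**.  For `Θ` continuous with compact support, `u ∈ ℂ`, `η ≠ 0`:
`ε² · ∫_{𝔹²} Θ(u•1 + (εη)•P(lift z)) dβ(z) ⟶ 9 ∫_{ℂ²} Θ(u•1 − η•N(W, |W|)) d⁴W` as `ε → 0⁺`, where `(W, |W|)` (`|W| = √(nsq W)`) runs over the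
NULL CONE `Q = 0` and `N(W,|W|)` over the square-zero rank-one matrices (★ `vecMulVec_star_mul_J_mul_self_of_Q_eq_zero`): the `ε²`-normalised
`K`-central orbital integrals of `U(2,1)` converge to the invariant integral over the (translated) minimal nilpotent cone.
[cite: Rogawski1990, §8.4 pp. 126–127] [cite: Varadarajan1989, §6.4] [cite: Rudin1980, §2.2] -/
theorem tendsto_sq_smul_integral_bergmanVolume_pencil {G : Type*} [NormedAddCommGroup G] [NormedSpace ℝ G]
    (Θ : Matrix (Fin 3) (Fin 3) ℂ → G) (hΘ : Continuous Θ) (hΘc : HasCompactSupport Θ) (u : ℂ) {η : ℂ} (hη : η ≠ 0) :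
    Tendsto (fun ε : ℝ => ε ^ 2 • (∫ z, Θ (u • (1 : Matrix (Fin 3) (Fin 3) ℂ) + ((ε : ℂ) * η) •
        ((((Q (lift z) : ℝ) : ℂ))⁻¹ • (vecMulVec (lift z) (star (lift z)) * J))) ∂bergmanVolume))
      (𝓝[>] 0)
      (𝓝 ((9 : ℝ) • ∫ W : Fin 2 → ℂ, Θ (u • (1 : Matrix (Fin 3) (Fin 3) ℂ) -
        η • (vecMulVec ![W 0, W 1, (Real.sqrt (nsq W) : ℂ)] (star ![W 0, W 1, (Real.sqrt (nsq W) : ℂ)]) * J)))) := by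
  have hcont := (continuousOn_integral_sheet Θ hΘ hΘc u hη).continuousWithinAt (Set.mem_Ici.2 (le_refl (0 : ℝ)))
  have h0 : (fun W : Fin 2 → ℂ => Θ (u • (1 : Matrix (Fin 3) (Fin 3) ℂ) -
      η • (vecMulVec ![W 0, W 1, (Real.sqrt (0 + nsq W) : ℂ)] (star ![W 0, W 1, (Real.sqrt (0 + nsq W) : ℂ)]) * J))) =
      fun W : Fin 2 → ℂ => Θ (u • (1 : Matrix (Fin 3) (Fin 3) ℂ) -
      η • (vecMulVec ![W 0, W 1, (Real.sqrt (nsq W) : ℂ)] (star ![W 0, W 1, (Real.sqrt (nsq W) : ℂ)]) * J)) := by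
    simp only [zero_add]
  have hlim := ((hcont.tendsto.mono_left (nhdsWithin_mono _ Ioi_subset_Ici_self)).const_smul (9 : ℝ))
  rw [h0] at hlim
  refine hlim.congr' ?_
  filter_upwards [self_mem_nhdsWithin] with ε hε
  exact (sq_smul_integral_bergmanVolume_pencil_eq_chart Θ u η hε).symm

end Literature.Geometry.ComplexHyperbolic.BallModel

end
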